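import Mathlib
import HarnessLib
import Summits.MatrixMultiplication.MatrixMultiplication.Theses.SnSubsetDichotomy
import Summits.MatrixMultiplication.MatrixMultiplication.Theorems.SnSubsetDichotomyPolynomialSlackStubTransport
import Summits.MatrixMultiplication.MatrixMultiplication.Theorems.SnSubsetDichotomyPolynomialSlackStubSplit
import Summits.MatrixMultiplication.MatrixMultiplication.Theorems.SnSubsetDichotomyPolynomialSlackStubBalancedSplit

/-!
# Line `transport-split-hull` — skeleton for crux `PolynomialSlack`
(stmt-MatrixMultiplication-8306, route SnSubsetDichotomy, rank 5)

TRANSPORT · SPLIT · HULL.  For a TPP triple `(S,T,U)` in `S_n` the `N = |S||T||U|` trivial solutions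
`(s⁻¹t)(t⁻¹u) = s⁻¹u` couple the quotient sets `A = S⁻¹T`, `B = T⁻¹U`, `C′ = S⁻¹U`, so every
EXACTLY product-free triple `(H₁,H₂,H₃)` has `μ_A(H₁) + μ_B(H₂) + μ_{C′}(H₃) ≤ 2` (`stub_transport`,
TPP-free count form); for a partition `T = T₁ ⊔ T₂` the split configuration `(S⁻¹T₁, T₂⁻¹U, S⁻¹U)` is
exactly product-free and poly-dense (`stub_split`, the only place the 3-fold TPP condition enters);
a uniformly random half `T₁` balances every bounded test function from a family of size
`< e^{2δ²|T|}/2` simultaneously (`stub_balancedSplit`, Hoeffding + union bound, existence form); hence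
if poly-dense exactly product-free triples of `S_n` admit `80%`-capturing product-free HULLS from a
family of size `exp(√(n!)/n^{C+1})` (`stub_hull`, the load-bearing open stub = the idea's C⁺
`ProductFreeHull`), the hull of the split triple captures `≈ 80%` of ALL of `A`, `B`, `C′` and the
transport inequality reads `2.04 ≤ 2`.  Composition `PolynomialSlack_of` (sorry-free below the stubs):
WLOG `C ≥ 1`; hull theorem at exponent `2C+1`; `δ = 1/20`; the room `|T| > √(n!)/n^C ≥ 800` against
`log|𝓗| ≤ √(n!)/n^{2C+2}` is closed by `factorial_dominates`.  See `Lines/transport-split-hull.md`.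

STATUS (lead prover-line-stmt-MatrixMultiplication-8306-0, cycle 1, 2026-08-16): three of the four registered
stubs are LANDED in the tree and imported here — `stub_transport` (Theorems/…StubTransport.lean, p76174),
`stub_split` (…StubSplit.lean, p76079), `stub_balancedSplit` (…StubBalancedSplit.lean, p76175); the per-`n`
theorem `core` is now closed with axioms {propext, Classical.choice, Quot.sound}.  The ONLY remaining `sorry`
is `stub_hull` (open; its junta form is refuted in Theorems/…HullShape.lean — hulls must include Kedlaya-type
set-system configurations; see Cruxes/PolynomialSlack/NOTES.md).  So `stub_hull → PolynomialSlack` is a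
theorem of the tree modulo the single named statement `stub_hull`.
-/

set_option linter.dupNamespace false

open scoped BigOperators
open Finset

namespace Summit.MatrixMultiplication.MatrixMultiplication.Cruxes.PolynomialSlack.TransportSplitHull

open Literature.Combinatorics.Additive (TripleProductProperty)

/-! ## The four stubs

Notation used informally in the docstrings (everything is written out in the statements):
* `A = S⁻¹T := image₂ (fun s t => s⁻¹ * t) S T`, `B = T⁻¹U`, `C′ = S⁻¹U` — the quotient sets;
* `(X,Y,Z)` EXACTLY PRODUCT-FREE `:≡ ∀ x ∈ X, ∀ y ∈ Y, x * y ∉ Z`;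
* fibre counts `f_H(t) := #{s ∈ S | s⁻¹t ∈ H}`, `g_H(t) := #{u ∈ U | t⁻¹u ∈ H}`.
-/

/-- **stub_transport** (THE TRANSPORT INEQUALITY, count form; TPP-free; provable now, size M).
For ANY finite `S, T, U ⊆ S_n` and any exactly product-free `(H₁,H₂,H₃)`, each triple `(s,t,u)`
satisfies at most two of `s⁻¹t ∈ H₁`, `t⁻¹u ∈ H₂`, `s⁻¹u ∈ H₃` (because `(s⁻¹t)(t⁻¹u) = s⁻¹u`);
summing over `S × T × U` and collecting fibres:
`|U|·Σ_t f_{H₁}(t) + |S|·Σ_t g_{H₂}(t) + |T|·#{(s,u) | s⁻¹u ∈ H₃} ≤ 2|S||T||U|`.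
Under the TPP the three counts are `|A ∩ H₁|·|U|`, `|B ∩ H₂|·|S|`, `|C′ ∩ H₃|·|T|` (`stub_split` (b)),
i.e. `μ_A(H₁) + μ_B(H₂) + μ_{C′}(H₃) ≤ 2`; tight on split configurations. (Triage r1-3 mutation
finding: the TPP is not needed for this cleared-denominator form.) -/
theorem stub_transport (n : ℕ) (S T U H₁ H₂ H₃ : Finset (Equiv.Perm (Fin n)))
    (hH : ∀ x ∈ H₁, ∀ y ∈ H₂, x * y ∉ H₃) :
    U.card * ∑ t ∈ T, (S.filter (fun s => s⁻¹ * t ∈ H₁)).card +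
        S.card * ∑ t ∈ T, (U.filter (fun u => t⁻¹ * u ∈ H₂)).card +
        T.card * ((S ×ˢ U).filter (fun su => su.1⁻¹ * su.2 ∈ H₃)).card ≤
      2 * (S.card * T.card * U.card) :=
  -- LANDED: Theorems/SnSubsetDichotomyPolynomialSlackStubTransport.lean (p76174)
  Summit.MatrixMultiplication.MatrixMultiplication.Theorems.PolynomialSlack.stub_transport
    n S T U H₁ H₂ H₃ hH

/-- **stub_split** (THE SPLIT CONFIGURATION; the only use of the 3-fold TPP; provable now, size M).
For a TPP triple with all three sets non-empty and disjoint `T₁, T₂ ⊆ T`: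
(a) `(S⁻¹T₁, T₂⁻¹U, S⁻¹U)` is EXACTLY product-free — `(s⁻¹t₁)(t₂⁻¹u) = s′⁻¹u′` gives
`s′s⁻¹·t₁t₂⁻¹·uu′⁻¹ = 1`, so `t₁ = t₂ ∈ T₁ ∩ T₂ = ∅` (honours Disproof §2: false without the triple
condition); (b) the three quotient maps `(s,t) ↦ s⁻¹t`, `(t,u) ↦ t⁻¹u`, `(s,u) ↦ s⁻¹u` are injective
(pairwise TPP), stated as exact fibre-count identities against every test set `H`;
(c) packing `|S||T|, |T||U|, |S||U| ≤ n!` (pattern `RealizesTPP.mul_le_card`). -/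
theorem stub_split (n : ℕ) (S T U T₁ T₂ : Finset (Equiv.Perm (Fin n)))
    (hTPP : TripleProductProperty S T U) (hS : S.Nonempty) (hT : T.Nonempty) (hU : U.Nonempty)
    (h₁ : T₁ ⊆ T) (h₂ : T₂ ⊆ T) (hdisj : Disjoint T₁ T₂) :
    (∀ x ∈ Finset.image₂ (fun s t => s⁻¹ * t) S T₁, ∀ y ∈ Finset.image₂ (fun t u => t⁻¹ * u) T₂ U,
        x * y ∉ Finset.image₂ (fun s u => s⁻¹ * u) S U) ∧
    (∀ H : Finset (Equiv.Perm (Fin n)),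
        ∑ t ∈ T₁, (S.filter (fun s => s⁻¹ * t ∈ H)).card =
          (Finset.image₂ (fun s t => s⁻¹ * t) S T₁ ∩ H).card) ∧
    (∀ H : Finset (Equiv.Perm (Fin n)),
        ∑ t ∈ T₂, (U.filter (fun u => t⁻¹ * u ∈ H)).card =
          (Finset.image₂ (fun t u => t⁻¹ * u) T₂ U ∩ H).card) ∧
    (∀ H : Finset (Equiv.Perm (Fin n)),
        ((S ×ˢ U).filter (fun su => su.1⁻¹ * su.2 ∈ H)).card =
          (Finset.image₂ (fun s u => s⁻¹ * u) S U ∩ H).card) ∧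
    S.card * T.card ≤ n.factorial ∧ T.card * U.card ≤ n.factorial ∧
      S.card * U.card ≤ n.factorial :=
  -- LANDED: Theorems/SnSubsetDichotomyPolynomialSlackStubSplit.lean (p76079)
  Summit.MatrixMultiplication.MatrixMultiplication.Theorems.PolynomialSlack.stub_split
    n S T U T₁ T₂ hTPP hS hT hU h₁ h₂ hdisj

/-- **stub_balancedSplit** (EXCHANGEABILITY: Hoeffding for half-sampling + union bound, existence
form; provable now, size L). For a finite family `(f_i)_{i ∈ ι}` of test functions on `T` with
`0 ≤ f_i ≤ M_i`, if `2|ι|·e^{-2δ²|T|} < 1` then ONE subset `T₁ ⊆ T` balances them all: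
`|Σ_{T₁} f_i − ½Σ_T f_i| < δ·M_i·|T|` for every `i`. (Uniformly random `T₁`: `Σ_{T₁} f_i = Σ_t ε_t f_i(t)`
with independent `ε_t ∈ {0,1}`; Hoeffding `P(|dev| ≥ λ) ≤ 2e^{-2λ²/Σ_t f_i(t)²} ≤ 2e^{-2δ²|T|}` at
`λ = δM_i|T|`; union bound. Finite proof: `Finset.prod_one_add` + `Real.cosh_le_exp_half_sq`;
or Mathlib's `ProbabilityTheory.measure_sum_ge_le_of_iIndepFun`.) -/
theorem stub_balancedSplit {α ι : Type*} [DecidableEq α] [Fintype ι] (T : Finset α)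
    (f : ι → α → ℝ) (M : ι → ℝ) (δ : ℝ) (hδ : 0 < δ) (hM : ∀ i, 0 < M i)
    (hf : ∀ i, ∀ t ∈ T, 0 ≤ f i t ∧ f i t ≤ M i)
    (hι : 2 * (Fintype.card ι : ℝ) * Real.exp (-(2 * δ ^ 2 * T.card)) < 1) :
    ∃ T₁ ⊆ T, ∀ i, |∑ t ∈ T₁, f i t - (∑ t ∈ T, f i t) / 2| < δ * M i * T.card :=
  -- LANDED: Theorems/SnSubsetDichotomyPolynomialSlackStubBalancedSplit.lean (p76175)
  Summit.MatrixMultiplication.MatrixMultiplication.Theorems.PolynomialSlack.stub_balancedSplit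
    T f M δ hδ hM hf hι

/-- **stub_hull** (PRODUCT-FREE HULLS — the idea's transfer `C⁺ = ProductFreeHull`, uniform over
`S_n`; the load-bearing OPEN stub, hardest). For every `C` and all large `n` there is a family `𝓗` of
exactly product-free triples in `S_n` with `|𝓗| ≤ exp(√(n!)/n^{C+1})` such that every exactly
product-free `(X,Y,Z)` with `|X|·n^C, |Y|·n^C, |Z|·n^C ≥ n!` is `80%`-captured coordinatewise by
some `H ∈ 𝓗` (any capture ratio `ρ` with `ρ(3−4δ) > 2+4δ` would do for the composition; `4/5`
is registered). A container/stability statement about ONE hypergraph (the multiplication table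
of `S_n`) at POLYNOMIAL density — no TPP, no sets of size `√(n!)`. Expected proof shape (triage r1-1):
junta form — hulls definable from `O_C(1)` coordinates (`log|𝓗| = n^{O(C)}`, far inside the
budget); parity classes are themselves hulls, so no restriction to `A_n` is needed. Why it might
fail: needs exactness + simultaneous `80%` capture, i.e. a three-set KLM-type stability theorem with
exact junta envelopes (arXiv:2205.15191, arXiv:2307.15030 Thm 1.12/1.14, doi:10.19086/da.610);
generic hypergraph containers sit at `log|𝓗| ≈ √(n!)·n log n` and are not exact. -/
theorem stub_hull (C : ℝ) : ∃ n₀ : ℕ, ∀ n ≥ n₀,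
    ∃ 𝓗 : Finset (Finset (Equiv.Perm (Fin n)) × Finset (Equiv.Perm (Fin n)) ×
        Finset (Equiv.Perm (Fin n))),
      (𝓗.card : ℝ) ≤ Real.exp (Real.sqrt (n.factorial : ℝ) / (n : ℝ) ^ (C + 1)) ∧
      (∀ H ∈ 𝓗, ∀ x ∈ H.1, ∀ y ∈ H.2.1, x * y ∉ H.2.2) ∧
      ∀ X Y Z : Finset (Equiv.Perm (Fin n)),
        (n.factorial : ℝ) ≤ (X.card : ℝ) * (n : ℝ) ^ C →
        (n.factorial : ℝ) ≤ (Y.card : ℝ) * (n : ℝ) ^ C →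
        (n.factorial : ℝ) ≤ (Z.card : ℝ) * (n : ℝ) ^ C →
        (∀ x ∈ X, ∀ y ∈ Y, x * y ∉ Z) →
        ∃ H ∈ 𝓗, 4 * X.card ≤ 5 * (X ∩ H.1).card ∧ 4 * Y.card ≤ 5 * (Y ∩ H.2.1).card ∧
          4 * Z.card ≤ 5 * (Z ∩ H.2.2).card := by
  sorry

/-! ## Composition (sorry-free below this line) -/

/-- Polynomials are eventually dominated by the factorial: `A·n^j ≤ n!` for `n ≥ N(A,j)`. -/
theorem factorial_dominates (A : ℝ) (j : ℕ) :
    ∃ N : ℕ, ∀ n ≥ N, A * (n : ℝ) ^ j ≤ (n.factorial : ℝ) := by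
  refine ⟨2 * (j + 1) + ⌈A * 2 ^ (j + 1)⌉₊, fun n hn => ?_⟩
  have hj : j + 1 ≤ n := by omega
  have hfac : (n - (j + 1) + 1) ^ (j + 1) ≤ n.factorial := by
    have h := @Nat.factorial_mul_pow_le_factorial (n - (j + 1)) (j + 1)
    rw [Nat.sub_add_cancel hj] at h
    exact le_trans (Nat.le_mul_of_pos_left _ (Nat.factorial_pos _)) h
  have hq : (n : ℝ) / 2 ≤ ((n - (j + 1) + 1 : ℕ) : ℝ) := by
    have e : (n - (j + 1) + 1 : ℕ) = n - j := by omega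
    rw [e, Nat.cast_sub (by omega)]
    have h2 : ((2 * j : ℕ) : ℝ) ≤ n := by exact_mod_cast (show 2 * j ≤ n by omega)
    push_cast at h2
    linarith
  have hA : A * 2 ^ (j + 1) ≤ n := by
    have h1 : A * 2 ^ (j + 1) ≤ ⌈A * 2 ^ (j + 1)⌉₊ := Nat.le_ceil _
    have h2 : ((⌈A * 2 ^ (j + 1)⌉₊ : ℕ) : ℝ) ≤ n := by exact_mod_cast (show ⌈A * 2 ^ (j + 1)⌉₊ ≤ n by omega)
    exact h1.trans h2
  have hn0 : (0 : ℝ) ≤ n := Nat.cast_nonneg n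
  calc A * (n : ℝ) ^ j ≤ ((n : ℝ) / 2 ^ (j + 1)) * (n : ℝ) ^ j := by
        apply mul_le_mul_of_nonneg_right _ (by positivity)
        rw [le_div_iff₀ (by positivity)]
        exact hA
    _ = ((n : ℝ) / 2) ^ (j + 1) := by rw [div_pow, pow_succ]; ring
    _ ≤ (((n - (j + 1) + 1 : ℕ) : ℝ)) ^ (j + 1) := pow_le_pow_left₀ (by positivity) hq _
    _ ≤ (n.factorial : ℝ) := by exact_mod_cast hfac

theorem six_lt_exp_two : (6 : ℝ) < Real.exp 2 := by
  have h := Real.exp_one_gt_d9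
  have h2 : Real.exp 2 = Real.exp 1 * Real.exp 1 := by rw [← Real.exp_add]; norm_num
  rw [h2]
  nlinarith [Real.exp_pos 1]


set_option maxHeartbeats 1600000 in
/-- **The per-`n` estimate.** At one fixed `n ≥ 8`, for `C ≥ 1`, given the hull family of
`stub_hull` at exponent `2C+1` and the room `800·n^C ≤ √(n!)`, every TPP triple has
`|S||T||U|·n^C ≤ n!·√(n!)`. Proof = the idea: pack, split at a balanced `T₁` (`stub_balancedSplit`
against the `2|𝓗|+1` test functions `f_H, g_H, 1`), capture the split triple by a hull, transport. -/
theorem core (n : ℕ) (hn8 : 8 ≤ n) (C : ℝ) (hC : 1 ≤ C)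
    (S T U : Finset (Equiv.Perm (Fin n))) (hTPP : TripleProductProperty S T U)
    (𝓗 : Finset (Finset (Equiv.Perm (Fin n)) × Finset (Equiv.Perm (Fin n)) ×
      Finset (Equiv.Perm (Fin n))))
    (h𝓗card : (𝓗.card : ℝ) ≤ Real.exp (Real.sqrt (n.factorial : ℝ) / (n : ℝ) ^ (2 * C + 1 + 1)))
    (h𝓗pf : ∀ H ∈ 𝓗, ∀ x ∈ H.1, ∀ y ∈ H.2.1, x * y ∉ H.2.2)
    (h𝓗cap : ∀ X Y Z : Finset (Equiv.Perm (Fin n)),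
        (n.factorial : ℝ) ≤ (X.card : ℝ) * (n : ℝ) ^ (2 * C + 1) →
        (n.factorial : ℝ) ≤ (Y.card : ℝ) * (n : ℝ) ^ (2 * C + 1) →
        (n.factorial : ℝ) ≤ (Z.card : ℝ) * (n : ℝ) ^ (2 * C + 1) →
        (∀ x ∈ X, ∀ y ∈ Y, x * y ∉ Z) →
        ∃ H ∈ 𝓗, 4 * X.card ≤ 5 * (X ∩ H.1).card ∧ 4 * Y.card ≤ 5 * (Y ∩ H.2.1).card ∧
          4 * Z.card ≤ 5 * (Z ∩ H.2.2).card)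
    (hW : 800 * (n : ℝ) ^ C ≤ Real.sqrt (n.factorial : ℝ)) :
    ((S.card * T.card * U.card : ℕ) : ℝ) * (n : ℝ) ^ C ≤
      (n.factorial : ℝ) * Real.sqrt (n.factorial : ℝ) := by
  -- degenerate case: an empty factor
  rcases Nat.eq_zero_or_pos (S.card * T.card * U.card) with hzero | hpos
  · rw [hzero]; push_cast; rw [zero_mul]; positivity
  have hS0 : S.card ≠ 0 := fun h => by rw [h] at hpos; simp at hpos
  have hT0 : T.card ≠ 0 := fun h => by rw [h] at hpos; simp at hpos
  have hU0 : U.card ≠ 0 := fun h => by rw [h] at hpos; simp at hpos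
  have hSne : S.Nonempty := Finset.card_ne_zero.mp hS0
  have hTne : T.Nonempty := Finset.card_ne_zero.mp hT0
  have hUne : U.Nonempty := Finset.card_ne_zero.mp hU0
  -- real abbreviations
  obtain ⟨a, ha⟩ : ∃ a : ℝ, a = S.card := ⟨_, rfl⟩
  obtain ⟨b, hb⟩ : ∃ b : ℝ, b = T.card := ⟨_, rfl⟩
  obtain ⟨c, hc⟩ : ∃ c : ℝ, c = U.card := ⟨_, rfl⟩
  obtain ⟨F, hF⟩ : ∃ F : ℝ, F = n.factorial := ⟨_, rfl⟩
  obtain ⟨P, hP⟩ : ∃ P : ℝ, P = (n : ℝ) ^ C := ⟨_, rfl⟩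
  have ha0 : 0 < a := by rw [ha]; exact_mod_cast Nat.pos_of_ne_zero hS0
  have hb0 : 0 < b := by rw [hb]; exact_mod_cast Nat.pos_of_ne_zero hT0
  have hc0 : 0 < c := by rw [hc]; exact_mod_cast Nat.pos_of_ne_zero hU0
  have hn1 : (1 : ℝ) ≤ n := by exact_mod_cast (le_trans (by norm_num) hn8)
  have hn8r : (8 : ℝ) ≤ n := by exact_mod_cast hn8
  have hn0 : (0 : ℝ) < n := by linarith
  have hF0 : 0 < F := by rw [hF]; exact_mod_cast n.factorial_pos
  have hP0 : 0 < P := by rw [hP]; exact Real.rpow_pos_of_pos hn0 C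
  have hsqF0 : 0 < Real.sqrt F := Real.sqrt_pos.mpr hF0
  have hgoal : ((S.card * T.card * U.card : ℕ) : ℝ) * (n : ℝ) ^ C = a * b * c * P := by
    push_cast; rw [ha, hb, hc, hP]
  rw [hgoal, ← hF]
  refine not_lt.mp fun hlt => ?_
  -- packing (stub_split (c), with the trivial split)
  obtain ⟨-, -, -, -, hpST, hpTU, hpSU⟩ := stub_split n S T U ∅ ∅ hTPP hSne hTne hUne
    (Finset.empty_subset _) (Finset.empty_subset _) (disjoint_bot_left)
  have h3 : a * b ≤ F := by rw [ha, hb, hF]; exact_mod_cast hpST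
  have h2 : b * c ≤ F := by rw [hb, hc, hF]; exact_mod_cast hpTU
  have h1 : a * c ≤ F := by rw [ha, hc, hF]; exact_mod_cast hpSU
  -- (i) every factor exceeds √(n!)/n^C : here for `T`
  have hbP : Real.sqrt F < b * P := by
    have : Real.sqrt F * F < (b * P) * F := by
      calc Real.sqrt F * F = F * Real.sqrt F := mul_comm _ _
        _ < a * b * c * P := hlt
        _ = (b * P) * (a * c) := by ring
        _ ≤ (b * P) * F := by apply mul_le_mul_of_nonneg_left h1; positivity
    exact lt_of_mul_lt_mul_right this hF0.le
  -- (ii) every quotient set is `n^{-2C}`-dense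
  have hF3 : F ^ 3 < (a * b * c * P) ^ 2 := by
    have e : F ^ 3 = (F * Real.sqrt F) ^ 2 := by
      rw [mul_pow, Real.sq_sqrt hF0.le]; ring
    rw [e]
    exact pow_lt_pow_left₀ hlt (by positivity) two_ne_zero
  have habP : F < a * b * P ^ 2 := by
    have : F * F ^ 2 < (a * b * P ^ 2) * F ^ 2 := by
      calc F * F ^ 2 = F ^ 3 := by ring
        _ < (a * b * c * P) ^ 2 := hF3
        _ = (a * b * P ^ 2) * ((a * c) * (b * c)) := by ring
        _ ≤ (a * b * P ^ 2) * (F * F) := by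
            apply mul_le_mul_of_nonneg_left _ (by positivity)
            exact mul_le_mul h1 h2 (by positivity) hF0.le
        _ = (a * b * P ^ 2) * F ^ 2 := by ring
    exact lt_of_mul_lt_mul_right this (by positivity)
  have hbcP : F < b * c * P ^ 2 := by
    have : F * F ^ 2 < (b * c * P ^ 2) * F ^ 2 := by
      calc F * F ^ 2 = F ^ 3 := by ring
        _ < (a * b * c * P) ^ 2 := hF3
        _ = (b * c * P ^ 2) * ((a * b) * (a * c)) := by ring
        _ ≤ (b * c * P ^ 2) * (F * F) := by
            apply mul_le_mul_of_nonneg_left _ (by positivity)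
            exact mul_le_mul h3 h1 (by positivity) hF0.le
        _ = (b * c * P ^ 2) * F ^ 2 := by ring
    exact lt_of_mul_lt_mul_right this (by positivity)
  have hacP : F < a * c * P ^ 2 := by
    have : F * F ^ 2 < (a * c * P ^ 2) * F ^ 2 := by
      calc F * F ^ 2 = F ^ 3 := by ring
        _ < (a * b * c * P) ^ 2 := hF3
        _ = (a * c * P ^ 2) * ((a * b) * (b * c)) := by ring
        _ ≤ (a * c * P ^ 2) * (F * F) := by
            apply mul_le_mul_of_nonneg_left _ (by positivity)
            exact mul_le_mul h3 h2 (by positivity) hF0.le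
        _ = (a * c * P ^ 2) * F ^ 2 := by ring
    exact lt_of_mul_lt_mul_right this (by positivity)
  -- the room: W := √(n!)/n^C ≥ 800, |T| > W, hull budget ≤ W/400
  obtain ⟨W, hWdef⟩ : ∃ W : ℝ, W = Real.sqrt F / P := ⟨_, rfl⟩
  have hW800 : 800 ≤ W := by rw [hWdef, le_div_iff₀ hP0, hF, hP]; exact hW
  have hbW : W < b := by rw [hWdef, div_lt_iff₀ hP0]; exact hbP
  have hQ : (400 : ℝ) ≤ (n : ℝ) ^ (C + 2) := by
    have h83 : (400 : ℝ) ≤ (n : ℝ) ^ (3 : ℝ) := by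
      rw [show (3 : ℝ) = ((3 : ℕ) : ℝ) by norm_num, Real.rpow_natCast]
      have h512 : (8 : ℝ) ^ 3 ≤ (n : ℝ) ^ 3 := pow_le_pow_left₀ (by norm_num) hn8r 3
      linarith
    calc (400 : ℝ) ≤ (n : ℝ) ^ (3 : ℝ) := h83
      _ ≤ (n : ℝ) ^ (C + 2) := Real.rpow_le_rpow_of_exponent_le hn1 (by linarith)
  have hBudget : Real.sqrt F / (n : ℝ) ^ (2 * C + 1 + 1) ≤ W / 400 := by
    have e : (n : ℝ) ^ (2 * C + 1 + 1) = P * (n : ℝ) ^ (C + 2) := by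
      rw [hP, ← Real.rpow_add hn0]; congr 1; ring
    rw [e, hWdef, ← div_div]
    exact div_le_div_of_nonneg_left (by positivity) (by norm_num) hQ
  -- the test functions, indexed by `(𝓗 ⊕ 𝓗) ⊕ Unit`
  obtain ⟨δ, hδ⟩ : ∃ δ : ℝ, δ = 1 / 20 := ⟨_, rfl⟩
  have hδ0 : (0 : ℝ) < δ := by rw [hδ]; norm_num
  let ι := (↥𝓗 ⊕ ↥𝓗) ⊕ Unit
  let f : ι → Equiv.Perm (Fin n) → ℝ :=
    Sum.elim (Sum.elim (fun H t => ((S.filter (fun s => s⁻¹ * t ∈ H.1.1)).card : ℝ))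
        (fun H t => ((U.filter (fun u => t⁻¹ * u ∈ H.1.2.1)).card : ℝ)))
      (fun _ _ => 1)
  let M : ι → ℝ := Sum.elim (Sum.elim (fun _ => a) (fun _ => c)) (fun _ => 1)
  have hMpos : ∀ i, 0 < M i := by
    rintro ((H | H) | u)
    · simp only [M, Sum.elim_inl]; exact ha0
    · simp only [M, Sum.elim_inl, Sum.elim_inr]; exact hc0
    · simp only [M, Sum.elim_inr]; norm_num
  have hfM : ∀ i, ∀ t ∈ T, 0 ≤ f i t ∧ f i t ≤ M i := by
    rintro ((H | H) | u) t _
    · simp only [f, M, Sum.elim_inl]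
      exact ⟨Nat.cast_nonneg _, by rw [ha]; exact_mod_cast Finset.card_filter_le _ _⟩
    · simp only [f, M, Sum.elim_inl, Sum.elim_inr]
      exact ⟨Nat.cast_nonneg _, by rw [hc]; exact_mod_cast Finset.card_filter_le _ _⟩
    · simp only [f, M, Sum.elim_inr]; norm_num
  have hcardι : (Fintype.card ι : ℝ) = 𝓗.card + 𝓗.card + 1 := by
    simp only [ι, Fintype.card_sum, Fintype.card_coe, Fintype.card_unit]; push_cast; ring
  -- union bound: 2(2|𝓗|+1)e^{-2δ²|T|} < 6 e^{W/400} e^{-W/200} ≤ 6e^{-2} < 1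
  have hι : 2 * (Fintype.card ι : ℝ) * Real.exp (-(2 * δ ^ 2 * T.card)) < 1 := by
    rw [hcardι]
    have hE : Real.exp (Real.sqrt F / (n : ℝ) ^ (2 * C + 1 + 1)) ≤ Real.exp (W / 400) :=
      Real.exp_le_exp.mpr hBudget
    have hE1 : (1 : ℝ) ≤ Real.exp (W / 400) := Real.one_le_exp (by linarith)
    have hcardF : (𝓗.card : ℝ) ≤ Real.exp (W / 400) := by rw [hF] at hE; exact h𝓗card.trans hE
    have h6 : 2 * ((𝓗.card : ℝ) + 𝓗.card + 1) ≤ 6 * Real.exp (W / 400) := by linarith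
    have hexpT : Real.exp (-(2 * δ ^ 2 * T.card)) < Real.exp (-(W / 200)) := by
      rw [Real.exp_lt_exp, ← hb]
      have : 2 * δ ^ 2 * b = b / 200 := by rw [hδ]; ring
      rw [this]; linarith [hbW]
    have hWexp : 6 * Real.exp (W / 400) * Real.exp (-(W / 200)) ≤ 6 * Real.exp (-2) := by
      rw [mul_assoc, ← Real.exp_add]
      have : W / 400 + -(W / 200) ≤ -2 := by linarith [hW800]
      have := Real.exp_le_exp.mpr this
      linarith
    have he2 : 6 * Real.exp (-2) < 1 := by
      rw [Real.exp_neg, ← div_eq_mul_inv, div_lt_one (Real.exp_pos 2)]; exact six_lt_exp_two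
    calc 2 * ((𝓗.card : ℝ) + 𝓗.card + 1) * Real.exp (-(2 * δ ^ 2 * T.card))
        ≤ 6 * Real.exp (W / 400) * Real.exp (-(2 * δ ^ 2 * T.card)) :=
          mul_le_mul_of_nonneg_right h6 (Real.exp_pos _).le
      _ < 6 * Real.exp (W / 400) * Real.exp (-(W / 200)) := by
          apply mul_lt_mul_of_pos_left hexpT; positivity
      _ ≤ 6 * Real.exp (-2) := hWexp
      _ < 1 := he2
  -- SPLIT: a balanced half `T₁` and its complement `T₂`
  obtain ⟨T₁, hT₁T, hbal⟩ := stub_balancedSplit T f M δ hδ0 hMpos hfM hι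
  obtain ⟨T₂, hT₂def⟩ : ∃ T₂ : Finset (Equiv.Perm (Fin n)), T₂ = T \ T₁ := ⟨_, rfl⟩
  have hT₂T : T₂ ⊆ T := by rw [hT₂def]; exact Finset.sdiff_subset
  have hdisj : Disjoint T₁ T₂ := by rw [hT₂def]; exact Finset.disjoint_sdiff
  have hT₁size : |(T₁.card : ℝ) - b / 2| < δ * b := by
    have h := hbal (Sum.inr ())
    simp only [f, M, Sum.elim_inr, Finset.sum_const, nsmul_eq_mul, mul_one] at h
    rw [← hb] at h
    exact h
  have hT₁lo : (1 / 2 - δ) * b < T₁.card := by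
    have := (abs_lt.mp hT₁size).1; linarith
  have hT₁hi : (T₁.card : ℝ) < (1 / 2 + δ) * b := by
    have := (abs_lt.mp hT₁size).2; linarith
  have hT₂card : (T₂.card : ℝ) = b - T₁.card := by
    rw [hT₂def, Finset.card_sdiff_of_subset hT₁T, Nat.cast_sub (Finset.card_le_card hT₁T), hb]
  have hT₂lo : (1 / 2 - δ) * b < T₂.card := by rw [hT₂card]; linarith
  -- the split configuration (stub_split (a), (b))
  obtain ⟨hpf, hcnt₁, hcnt₂, hcnt₃, -, -, -⟩ :=
    stub_split n S T U T₁ T₂ hTPP hSne hTne hUne hT₁T hT₂T hdisj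
  obtain ⟨X, hXdef⟩ : ∃ X : Finset (Equiv.Perm (Fin n)),
      X = Finset.image₂ (fun s t => s⁻¹ * t) S T₁ := ⟨_, rfl⟩
  obtain ⟨Y, hYdef⟩ : ∃ Y : Finset (Equiv.Perm (Fin n)),
      Y = Finset.image₂ (fun t u => t⁻¹ * u) T₂ U := ⟨_, rfl⟩
  obtain ⟨Z, hZdef⟩ : ∃ Z : Finset (Equiv.Perm (Fin n)),
      Z = Finset.image₂ (fun s u => s⁻¹ * u) S U := ⟨_, rfl⟩
  rw [← hXdef, ← hYdef, ← hZdef] at hpf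
  simp only [← hXdef] at hcnt₁
  simp only [← hYdef] at hcnt₂
  simp only [← hZdef] at hcnt₃
  -- cardinalities of the split sets
  have hXcard : (X.card : ℝ) = a * T₁.card := by
    have h := hcnt₁ Finset.univ
    rw [Finset.inter_univ] at h
    have e : ∀ t ∈ T₁, (S.filter (fun s => s⁻¹ * t ∈ (Finset.univ : Finset (Equiv.Perm (Fin n))))).card
        = S.card := by
      intro t _; rw [Finset.filter_true_of_mem (fun s _ => Finset.mem_univ _)]
    rw [Finset.sum_congr rfl e, Finset.sum_const, smul_eq_mul] at h
    rw [← h, ha]; push_cast; ring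
  have hYcard : (Y.card : ℝ) = T₂.card * c := by
    have h := hcnt₂ Finset.univ
    rw [Finset.inter_univ] at h
    have e : ∀ t ∈ T₂, (U.filter (fun u => t⁻¹ * u ∈ (Finset.univ : Finset (Equiv.Perm (Fin n))))).card
        = U.card := by
      intro t _; rw [Finset.filter_true_of_mem (fun u _ => Finset.mem_univ _)]
    rw [Finset.sum_congr rfl e, Finset.sum_const, smul_eq_mul] at h
    rw [← h, hc]; push_cast; ring
  have hZcard : (Z.card : ℝ) = a * c := by
    have h := hcnt₃ Finset.univ
    rw [Finset.inter_univ, Finset.filter_true_of_mem (fun su _ => Finset.mem_univ _),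
      Finset.card_product] at h
    rw [← h, ha, hc]; push_cast; ring
  -- densities of the split sets at exponent 2C+1
  have hP2 : (n : ℝ) ^ (2 * C + 1) = P ^ 2 * n := by
    rw [hP, Real.rpow_add hn0, Real.rpow_one, two_mul, Real.rpow_add hn0]; ring
  have hhalf : (1 : ℝ) ≤ (1 / 2 - δ) * n := by rw [hδ]; linarith
  have hdX : F ≤ (X.card : ℝ) * (n : ℝ) ^ (2 * C + 1) := by
    rw [hXcard, hP2]
    have h1 : a * b * P ^ 2 ≤ a * b * P ^ 2 * ((1 / 2 - δ) * n) :=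
      le_mul_of_one_le_right (by positivity) hhalf
    have h2 : a * b * P ^ 2 * ((1 / 2 - δ) * n) < a * T₁.card * (P ^ 2 * n) := by
      have hpos : 0 < a * P ^ 2 * n := by positivity
      calc a * b * P ^ 2 * ((1 / 2 - δ) * n) = (a * P ^ 2 * n) * ((1 / 2 - δ) * b) := by ring
        _ < (a * P ^ 2 * n) * T₁.card := mul_lt_mul_of_pos_left hT₁lo hpos
        _ = a * T₁.card * (P ^ 2 * n) := by ring
    linarith
  have hdY : F ≤ (Y.card : ℝ) * (n : ℝ) ^ (2 * C + 1) := by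
    rw [hYcard, hP2]
    have h1 : b * c * P ^ 2 ≤ b * c * P ^ 2 * ((1 / 2 - δ) * n) :=
      le_mul_of_one_le_right (by positivity) hhalf
    have h2 : b * c * P ^ 2 * ((1 / 2 - δ) * n) < T₂.card * c * (P ^ 2 * n) := by
      have hpos : 0 < c * P ^ 2 * n := by positivity
      calc b * c * P ^ 2 * ((1 / 2 - δ) * n) = (c * P ^ 2 * n) * ((1 / 2 - δ) * b) := by ring
        _ < (c * P ^ 2 * n) * T₂.card := mul_lt_mul_of_pos_left hT₂lo hpos
        _ = T₂.card * c * (P ^ 2 * n) := by ring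
    linarith
  have hdZ : F ≤ (Z.card : ℝ) * (n : ℝ) ^ (2 * C + 1) := by
    rw [hZcard, hP2]
    have h1 : a * c * P ^ 2 ≤ a * c * P ^ 2 * n := le_mul_of_one_le_right (by positivity) hn1
    linarith
  -- HULL: capture the split triple
  rw [hF] at hdX hdY hdZ
  obtain ⟨H, hH𝓗, hcX, hcY, hcZ⟩ := h𝓗cap X Y Z hdX hdY hdZ hpf
  have hcXr : 4 * (X.card : ℝ) ≤ 5 * ((X ∩ H.1).card : ℝ) := by exact_mod_cast hcX
  have hcYr : 4 * (Y.card : ℝ) ≤ 5 * ((Y ∩ H.2.1).card : ℝ) := by exact_mod_cast hcY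
  have hcZr : 4 * (Z.card : ℝ) ≤ 5 * ((Z ∩ H.2.2).card : ℝ) := by exact_mod_cast hcZ
  -- TRANSPORT for the hull
  have htr := stub_transport n S T U H.1 H.2.1 H.2.2 (h𝓗pf H hH𝓗)
  obtain ⟨A₁, hA₁⟩ : ∃ A₁ : ℝ, A₁ = ∑ t ∈ T, ((S.filter (fun s => s⁻¹ * t ∈ H.1)).card : ℝ) :=
    ⟨_, rfl⟩
  obtain ⟨B₁, hB₁⟩ : ∃ B₁ : ℝ, B₁ = ∑ t ∈ T, ((U.filter (fun u => t⁻¹ * u ∈ H.2.1)).card : ℝ) :=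
    ⟨_, rfl⟩
  obtain ⟨C₁, hC₁⟩ : ∃ C₁ : ℝ,
      C₁ = (((S ×ˢ U).filter (fun su => su.1⁻¹ * su.2 ∈ H.2.2)).card : ℝ) := ⟨_, rfl⟩
  have htrR : c * A₁ + a * B₁ + b * C₁ ≤ 2 * (a * b * c) := by
    rw [hA₁, hB₁, hC₁, ha, hb, hc]; exact_mod_cast htr
  -- exchangeability for `f_H` : A₁ > (0.8 - 3.6δ)·ab
  have hsumX : ∑ t ∈ T₁, ((S.filter (fun s => s⁻¹ * t ∈ H.1)).card : ℝ) = ((X ∩ H.1).card : ℝ) := by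
    have := congrArg (Nat.cast (R := ℝ)) (hcnt₁ H.1); push_cast at this; exact this
  have hbalX := hbal (Sum.inl (Sum.inl ⟨H, hH𝓗⟩))
  simp only [f, M, Sum.elim_inl] at hbalX
  rw [hsumX, ← hA₁, ← hb] at hbalX
  have hA₁lo : (4 / 5 - 18 / 5 * δ) * (a * b) < A₁ := by
    have h1 := (abs_lt.mp hbalX).2
    have h2 : 4 / 5 * (a * ((1 / 2 - δ) * b)) < 4 / 5 * (a * T₁.card) := by
      have := mul_lt_mul_of_pos_left hT₁lo ha0; linarith
    rw [hXcard] at hcXr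
    linarith [h1, h2, hcXr]
  -- exchangeability for `g_H` : B₁ > (0.8 - 3.6δ)·bc
  have hsumY : ∑ t ∈ T₂, ((U.filter (fun u => t⁻¹ * u ∈ H.2.1)).card : ℝ) = ((Y ∩ H.2.1).card : ℝ) := by
    have := congrArg (Nat.cast (R := ℝ)) (hcnt₂ H.2.1); push_cast at this; exact this
  have hsdiff : ∑ t ∈ T₂, ((U.filter (fun u => t⁻¹ * u ∈ H.2.1)).card : ℝ) +
      ∑ t ∈ T₁, ((U.filter (fun u => t⁻¹ * u ∈ H.2.1)).card : ℝ) = B₁ := by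
    rw [hB₁, hT₂def]; exact Finset.sum_sdiff hT₁T
  have hbalY := hbal (Sum.inl (Sum.inr ⟨H, hH𝓗⟩))
  simp only [f, M, Sum.elim_inl, Sum.elim_inr] at hbalY
  rw [← hB₁, ← hb] at hbalY
  have hB₁lo : (4 / 5 - 18 / 5 * δ) * (b * c) < B₁ := by
    have h1 := (abs_lt.mp hbalY).1
    have h2 : 4 / 5 * (((1 / 2 - δ) * b) * c) < 4 / 5 * (T₂.card * c) := by
      have := mul_lt_mul_of_pos_right hT₂lo hc0; linarith
    rw [hYcard] at hcYr
    rw [hsumY] at hsdiff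
    linarith [h1, h2, hcYr, hsdiff]
  -- the third coordinate: C₁ ≥ 0.8·ac
  have hC₁lo : 4 / 5 * (a * c) ≤ C₁ := by
    have : C₁ = ((Z ∩ H.2.2).card : ℝ) := by rw [hC₁]; exact_mod_cast hcnt₃ H.2.2
    rw [hZcard] at hcZr
    linarith
  -- contradiction: 2.04·abc < c·A₁ + a·B₁ + b·C₁ ≤ 2·abc
  have habc : 0 < a * b * c := by positivity
  have k1 : c * ((4 / 5 - 18 / 5 * δ) * (a * b)) < c * A₁ := mul_lt_mul_of_pos_left hA₁lo hc0
  have k2 : a * ((4 / 5 - 18 / 5 * δ) * (b * c)) < a * B₁ := mul_lt_mul_of_pos_left hB₁lo ha0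
  have k3 : b * (4 / 5 * (a * c)) ≤ b * C₁ := mul_le_mul_of_nonneg_left hC₁lo hb0.le
  have e1 : c * ((4 / 5 - 18 / 5 * δ) * (a * b)) = (4 / 5 - 18 / 5 * δ) * (a * b * c) := by ring
  have e2 : a * ((4 / 5 - 18 / 5 * δ) * (b * c)) = (4 / 5 - 18 / 5 * δ) * (a * b * c) := by ring
  have e3 : b * (4 / 5 * (a * c)) = 4 / 5 * (a * b * c) := by ring
  rw [e1] at k1; rw [e2] at k2; rw [e3] at k3
  rw [hδ] at k1 k2
  linarith [k1, k2, k3, htrR, habc]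

/-- **Composition.** `stub_transport`, `stub_split`, `stub_balancedSplit`, `stub_hull` ⇒ the crux
`PolynomialSlack`, BY NAME. WLOG `C ≥ 1` (monotonicity in `C` for `n ≥ 1`); the hull theorem is
invoked at exponent `2·max(C,1)+1`; the room `800·n^C ≤ √(n!)` comes from `factorial_dominates`. -/
theorem PolynomialSlack_of :
    Summit.MatrixMultiplication.MatrixMultiplication.Theses.SnSubsetDichotomy.PolynomialSlack := by
  intro C
  obtain ⟨C₁, hC₁⟩ : ∃ C₁ : ℝ, C₁ = max C 1 := ⟨_, rfl⟩
  have hC₁1 : 1 ≤ C₁ := by rw [hC₁]; exact le_max_right _ _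
  have hCC₁ : C ≤ C₁ := by rw [hC₁]; exact le_max_left _ _
  obtain ⟨n₁, hn₁⟩ := stub_hull (2 * C₁ + 1)
  obtain ⟨k, hk⟩ : ∃ k : ℕ, k = ⌈C₁⌉₊ := ⟨_, rfl⟩
  obtain ⟨N, hN⟩ := factorial_dominates 640000 (2 * k)
  refine ⟨max (max n₁ N) 8, fun n hn S T U hTPP => ?_⟩
  have hn₁' : n₁ ≤ n := le_trans (le_trans (le_max_left _ _) (le_max_left _ _)) hn
  have hN' : N ≤ n := le_trans (le_trans (le_max_right _ _) (le_max_left _ _)) hn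
  have hn8 : 8 ≤ n := le_trans (le_max_right _ _) hn
  obtain ⟨𝓗, hcard, hpf, hcap⟩ := hn₁ n hn₁'
  have hn1 : (1 : ℝ) ≤ n := by exact_mod_cast le_trans (by norm_num) hn8
  have hW : 800 * (n : ℝ) ^ C₁ ≤ Real.sqrt (n.factorial : ℝ) := by
    have h1 : (n : ℝ) ^ C₁ ≤ (n : ℝ) ^ k := by
      rw [← Real.rpow_natCast]
      exact Real.rpow_le_rpow_of_exponent_le hn1 (by rw [hk]; exact Nat.le_ceil _)
    have h2 : 640000 * (n : ℝ) ^ (2 * k) ≤ n.factorial := hN n hN'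
    apply Real.le_sqrt_of_sq_le
    have h0 : 0 ≤ (n : ℝ) ^ C₁ := Real.rpow_nonneg (by positivity) C₁
    calc (800 * (n : ℝ) ^ C₁) ^ 2 = 640000 * ((n : ℝ) ^ C₁) ^ 2 := by ring
      _ ≤ 640000 * ((n : ℝ) ^ k) ^ 2 := by gcongr
      _ = 640000 * (n : ℝ) ^ (2 * k) := by rw [← pow_mul, mul_comm k 2]
      _ ≤ _ := h2
  have hmain := core n hn8 C₁ hC₁1 S T U hTPP 𝓗 hcard hpf hcap hW
  have hF0 : (0 : ℝ) < n.factorial := by exact_mod_cast n.factorial_pos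
  have hrpow : (n.factorial : ℝ) ^ ((3 : ℝ) / 2) =
      (n.factorial : ℝ) * Real.sqrt (n.factorial : ℝ) := by
    rw [show (3 : ℝ) / 2 = 1 + 1 / 2 by norm_num, Real.rpow_add hF0, Real.rpow_one,
      Real.sqrt_eq_rpow]
  rw [hrpow]
  calc ((S.card * T.card * U.card : ℕ) : ℝ) * (n : ℝ) ^ C
      ≤ ((S.card * T.card * U.card : ℕ) : ℝ) * (n : ℝ) ^ C₁ := by
        apply mul_le_mul_of_nonneg_left _ (by positivity)
        exact Real.rpow_le_rpow_of_exponent_le hn1 hCC₁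
    _ ≤ _ := hmain

end Summit.MatrixMultiplication.MatrixMultiplication.Cruxes.PolynomialSlack.TransportSplitHull
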